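import Summits.ResolutionOfSingularities.ResolutionOfSingularities.Theorems.PAlterationPicoverLocalBlowups
import Literature.AlgebraicGeometry.Resolution.BlowupsComposition
import Literature.AlgebraicGeometry.Resolution.BlowupsProduct
import Literature.AlgebraicGeometry.Resolution.BlowupsLocal
import Literature.AlgebraicGeometry.Resolution.BlowupsFlatBaseChange
import Literature.AlgebraicGeometry.Resolution.BlowupsIntegral
import Literature.AlgebraicGeometry.Resolution.BlowupsExistence
import Literature.AlgebraicGeometry.Resolution.Temkin2008Localization
import Literature.AlgebraicGeometry.Limits.IdealSheafExtension
import HarnessLib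

/-!
# Crux `AffineToGlobal` (stmt-ResolutionOfSingularities-15961), line `Sketch`: phased patching

Route `ResolutionOfSingularities/SectionAscent`, crux `AffineToGlobal`, line `Sketch` (regular
yardsticks), reshape 2. Support file (`--supports stmt-ResolutionOfSingularities-15961`),
registered stub `stub_phasedPatching` of the lead's skeleton: the global step of the line,
"phased patching", pure blow-up calculus (no use of the crux's hypothesis H, no kernel).

**Statement (`stub_phasedPatching`).** Let `Y` be an integral scheme of finite type over a
field, covered by finitely many open charts `φ i : T i ↪ Y` (`i < n`), each with a "yardstick"
blow-up `b i : R i → T i` along `𝓘 i` with `R i` integral, such that every blow-up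
`π : M → R i` has a blow-up `M' → M` with regular source and centre lying over `π(Sing M)`
(the fibre-supported desingularization property of `R i`). Let `σ₀ : S₀ → Y` be a blow-up
along `J ≠ 0` on which every extended centre `(φ i)_* (𝓘 i) ∩ 𝒪_Y` becomes an effective
Cartier divisor. Then `Y` has a resolution of singularities.

**Proof (phases).** Invariant `P k`: a blow-up `σ : S → Y` along a non-zero ideal sheaf, on
which all extended centres are effective Cartier divisors, and which is regular over the
charts `j < k`. `P 0` is `σ₀`. Phase `k < n` (`phase_step`, `phase_core`), chart `i = k`: over
the chart, `M = S ×_Y T i → T i` is a blow-up (flat base change, Görtz–Wedhorn Prop. 13.91 (2))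
principalizing `𝓘 i`, hence factors as a blow-up `t : M → R i` followed by `b i` (Stacks 080A
twice, `Picover.LocalBlowups.exists_isBlowup_factor`); the hypothesis on `R i` gives a blow-up
`M' → M` along `Q'` with `M'` regular and `V(Q')` in the `t`-saturation of `Sing M`; blow `S`
up along the extension `Qe = ι_* Q' ∩ 𝒪_S` (`ι : M ↪ S`), `τ : S₁ → S`. Then `τ ≫ σ` is a
blow-up of the Noetherian `Y` (Stacks 080B), the extended centres stay Cartier (Stacks 0809),
`S₁` is `M'` over the chart `i` (flat base change + uniqueness of blow-ups), and `S₁` stays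
regular over the charts `j < k`: `V(Qe)`, the closure of `ι(V(Q'))`, lies over
`Y ∖ ⋃_{j<k} φ j (T j)` because `σ ∘ ι = φ i ∘ b i ∘ t` is constant on `t`-fibres and a
singular point of `M` is singular in `S`, hence not over an earlier chart; off `V(Qe)` the
blow-up `τ` is a local isomorphism (Stacks 02OS). `Qe ≠ 0` because the point of `M` over the
generic point of `R i` is regular and alone in its `t`-fibre, hence off `V(Q')`; so `S₁` is
integral and the new centre on `Y` is non-zero. At `k = n` the charts cover, `S` is regular,
and `σ` is proper (Stacks 02NS) and birational (Stacks 02ND): a resolution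
(`IsBlowup.isResolution'`).

No new definitions; no statement item is restated. Pattern sources: the Noetherian induction
of `Theorems/PAlterationPicoverLocalBlowups.lean` (flat base change, uniqueness, isomorphism
off the centre) and the chart plumbing of `Theorems/SectionAscentAffineToGlobalYardstickModel.lean`.
[cite: StacksProject, Tags 080A, 080B, 02OS] [cite: GortzWedhorn2020, Prop. 13.91]
[cite: Temkin2008, Prop. 2.3.4]
-/

noncomputable section

set_option linter.dupNamespace false -- mandated namespace of this single-conjunct summit

open CategoryTheory CategoryTheory.Limits AlgebraicGeometry TopologicalSpace
open Literature.AlgebraicGeometry.Resolution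

namespace Summit.ResolutionOfSingularities.ResolutionOfSingularities.Theorems.AffineToGlobal.PhasedPatching

universe u

/-! ## Blow-up toolkit: small complements -/

/-- **A blow-up of an integral scheme with non-empty source has a regular point which is alone
in its fibre**: the centre `Qt` is non-zero, so the generic point `η` of `R` lies in the open
complement of `V(Qt)`, over which `t` is an isomorphism (Stacks 02OS); the point `m₀` of `M`
over `η` is then the only point of its fibre, and it is regular because `η` is
(`genericPoint_mem_regularLocus`) and `𝒪_{R,η} ≅ 𝒪_{M,m₀}`. [folklore] -/
theorem exists_regular_fibre_eq_self {M R : Scheme.{u}} [IsIntegral R] {t : M ⟶ R}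
    {Qt : R.IdealSheafData} (ht : IsBlowup t Qt) [Nonempty M] :
    ∃ m₀ : M, m₀ ∈ Scheme.regularLocus M ∧ ∀ m₁ : M, t m₁ = t m₀ → m₁ = m₀ := by
  -- the centre is non-zero (a blow-up along the zero ideal sheaf is empty)
  have hQt : Qt ≠ ⊥ := by
    rintro rfl
    exact ht.isEmpty_of_bot.false (Classical.arbitrary M)
  -- the generic point `η` of `R` lies off the centre, where `t` is an isomorphism
  let U : R.Opens := centreCompl Qt
  have hU : (U : Set R).Nonempty := centreCompl_nonempty hQt
  have hη : genericPoint R ∈ (U : Set R) :=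
    ((genericPoint_spec R).mem_open_set_iff U.2).mpr (by simpa using hU)
  haveI : IsIso (t ∣_ U) := ht.isIso_compl
  obtain ⟨z, hz⟩ := (ConcreteCategory.bijective_of_isIso (t ∣_ U).base).2 ⟨genericPoint R, hη⟩
  have htz : t z.1 = genericPoint R := by
    have := morphismRestrict_base_coe t U z
    rw [hz] at this
    exact this.symm
  have hzU : t z.1 ∈ U := by
    rw [htz]
    exact hη
  refine ⟨z.1, ?_, fun m₁ hm₁ => ?_⟩
  · rw [mem_regularLocus_iff_of_isIso_morphismRestrict t U z.1 hzU, htz]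
    exact genericPoint_mem_regularLocus R
  · have hm₁U : t m₁ ∈ U := by
      rw [hm₁]
      exact hzU
    have hinj := (ConcreteCategory.bijective_of_isIso (t ∣_ U).base).1
    have key : (t ∣_ U) ⟨m₁, hm₁U⟩ = (t ∣_ U) z := by
      apply Subtype.ext
      rw [morphismRestrict_base_coe, morphismRestrict_base_coe]
      exact hm₁
    exact congrArg Subtype.val (hinj key)

/-- **Regularity over the chart of a blow-up along an extended centre.** Let `ι : M → S` be a
quasi-compact open immersion, `Q'` an ideal sheaf on `M` whose blow-up `π' : M' → M` has
regular source, and `τ : S₁ → S` a blow-up along the extension `ι_* Q' ∩ 𝒪_S` (Mathlib's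
`Q'.map ι`, which restricts back to `Q'`). Then `S₁` is regular over the image of `ι`:
`S₁ ×_S M → M` is a blow-up along `Q'` (flat base change, Görtz–Wedhorn Prop. 13.91 (2)), hence
isomorphic to `M'` over `M` (uniqueness of blow-ups), and `S₁ ×_S M → S₁` is an open immersion
onto `τ⁻¹(ι(M))`. [cite: GortzWedhorn2020, Prop. 13.91 (2)] -/
theorem mem_regularLocus_of_mem_range {S₁ S M M' : Scheme.{u}} (ι : M ⟶ S) [IsOpenImmersion ι]
    [QuasiCompact ι] {Q' : M.IdealSheafData} {π' : M' ⟶ M} (hπ' : IsBlowup π' Q')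
    (hM' : Scheme.IsRegular M') {τ : S₁ ⟶ S} (hτ : IsBlowup τ (Q'.map ι)) (s : S₁)
    (hs : τ s ∈ Set.range ι) : s ∈ Scheme.regularLocus S₁ := by
  have hQ : (Q'.map ι).comap ι = Q' :=
    Literature.AlgebraicGeometry.Limits.comap_map_of_isOpenImmersion ι Q'
  have hT : IsBlowup (pullback.snd τ ι) Q' := by
    have h1 := hτ.pullback_snd_of_flat ι
    rwa [hQ] at h1
  obtain ⟨e, -, -⟩ := hT.unique hπ'
  have hs' : s ∈ Set.range (pullback.fst τ ι) := by
    rw [Scheme.Pullback.range_fst]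
    exact hs
  obtain ⟨p, rfl⟩ := hs'
  exact (mem_regularLocus_iff_of_flat_of_isPreimmersion _ p).mp
    ((mem_regularLocus_iff_of_flat_of_isPreimmersion e.hom p).mpr (hM' _))

/-- Off the centre of a blow-up `τ`, a point is regular iff its image is (the blow-up is an
isomorphism over the complement of the centre, Stacks 02OS). [cite: StacksProject, Tag 02OS] -/
theorem mem_regularLocus_iff_of_notMem_support {S₁ S : Scheme.{u}} {τ : S₁ ⟶ S}
    {Q : S.IdealSheafData} (hτ : IsBlowup τ Q) (s : S₁) (hs : τ s ∉ (Q.support : Set S)) :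
    s ∈ Scheme.regularLocus S₁ ↔ τ s ∈ Scheme.regularLocus S := by
  haveI := hτ.isIso_compl
  exact mem_regularLocus_iff_of_isIso_morphismRestrict τ
    ⟨(Q.support : Set S)ᶜ, Q.support.isClosed.isOpen_compl⟩ s hs

/-- The co-support of the extension `ι_* Q' ∩ 𝒪_S` of an ideal sheaf `Q'` along a quasi-compact
morphism `ι : M → S` is the closure of `ι(V(Q'))` (Mathlib's `support_map`); in particular it
lies in every closed set containing `ι(V(Q'))`. [folklore] -/
theorem support_map_subset_of_isClosed {M S : Scheme.{u}} (ι : M ⟶ S) [QuasiCompact ι]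
    (Q' : M.IdealSheafData) {C : Set S} (hC : IsClosed C)
    (h : ι '' (Q'.support : Set M) ⊆ C) : ((Q'.map ι).support : Set S) ⊆ C := by
  have h1 : ((Q'.map ι).support : Set S) = closure (ι '' (Q'.support : Set M)) := by
    rw [Scheme.IdealSheafData.support_map]
    rfl
  rw [h1]
  exact hC.closure_subset_iff.mpr h


/-! ## One phase over one chart -/

/-- **One phase of the patching, over one chart.** Data: a blow-up `σ : S → Y` (with `S`
Noetherian), an open chart `φ : T ↪ Y` with a "yardstick" blow-up `b : R → T` along `𝓘` (`R`
integral) such that the extended centre `φ_* 𝓘 ∩ 𝒪_Y` pulls back to an effective Cartier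
divisor on `S`, the fibre-supported desingularization property of `R` (`hfib`: every blow-up
`π : M → R` has a blow-up `M' → M` with `M'` regular and centre lying over `π(Sing M)`), a
cartesian-like square `ι ≫ σ = snd ≫ φ` with `ι : M ↪ S` an open immersion, `M ≠ ∅` and `snd` a
blow-up, and an open `W ⊆ Y` over which `S` is already regular. Conclusion: a blow-up
`τ : S₁ → S` along a NON-ZERO ideal sheaf such that `S₁` is regular over `W` and over `ι(M)`.
Construction: `snd` factors as a blow-up `t : M → R` followed by `b` (Stacks 080A twice,
`exists_isBlowup_factor`); `hfib` gives `π' : M' → M` along `Q'` with `M'` regular and `V(Q')`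
in the `t`-saturation of `Sing M`; blow `S` up along the extension `Qe = ι_* Q' ∩ 𝒪_S`. Over
`ι(M)` the result is `M'` (flat base change and uniqueness of blow-ups); `V(Qe)`, the closure of
`ι(V(Q'))`, lies over `Y ∖ W` because `σ ∘ ι = φ ∘ b ∘ t` is constant on `t`-fibres and
singular points of `M` are singular in `S`, hence not over `W`; so over `W` the blow-up `τ` is
an isomorphism near every point. Finally `Qe ≠ 0`: the point of `M` over the generic point of
`R` is regular and alone in its `t`-fibre, hence off `V(Q')`.
[cite: StacksProject, Tag 080A] [cite: GortzWedhorn2020, Prop. 13.91 (2)] -/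
theorem phase_core {Y S T R M : Scheme.{0}} [IsIntegral R] [IsNoetherian S]
    {σ : S ⟶ Y} {φ : T ⟶ Y} [IsOpenImmersion φ] [QuasiCompact φ] {b : R ⟶ T}
    {𝓘 : T.IdealSheafData} (hb : IsBlowup b 𝓘)
    (hfib : ∀ (M : Scheme.{0}) (π : M ⟶ R) (Q : R.IdealSheafData), IsBlowup π Q →
      ∃ (M' : Scheme.{0}) (π' : M' ⟶ M) (Q' : M.IdealSheafData), IsBlowup π' Q' ∧
        (∀ m ∈ Q'.support, ∃ m₁ : M, m₁ ∉ Scheme.regularLocus M ∧ π m = π m₁) ∧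
        Scheme.IsRegular M')
    (ι : M ⟶ S) [IsOpenImmersion ι] [Nonempty M] (snd : M ⟶ T) (hsq : ι ≫ σ = snd ≫ φ)
    {QT : T.IdealSheafData} (hsnd : IsBlowup snd QT)
    (hcart : IsEffectiveCartier ((𝓘.map φ).comap σ))
    {W : Set Y} (hW : IsOpen W) (hreg : ∀ s : S, σ s ∈ W → s ∈ Scheme.regularLocus S) :
    ∃ (S₁ : Scheme.{0}) (τ : S₁ ⟶ S) (Qe : S.IdealSheafData), IsBlowup τ Qe ∧ Qe ≠ ⊥ ∧
      (∀ s : S₁, σ (τ s) ∈ W → s ∈ Scheme.regularLocus S₁) ∧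
      ∀ s : S₁, τ s ∈ Set.range ι → s ∈ Scheme.regularLocus S₁ := by
  haveI : NoetherianSpace M := ι.isOpenEmbedding.isInducing.noetherianSpace
  -- the extended centre of the yardstick restricts back to `𝓘` and is Cartier on `M`
  have hJφ : (𝓘.map φ).comap φ = 𝓘 :=
    Literature.AlgebraicGeometry.Limits.comap_map_of_isOpenImmersion φ 𝓘
  have hcartM : IsEffectiveCartier (𝓘.comap snd) := by
    have h1 : ((𝓘.map φ).comap σ).comap ι = 𝓘.comap snd := by
      rw [← Scheme.IdealSheafData.comap_comp, hsq, Scheme.IdealSheafData.comap_comp, hJφ]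
    rw [← h1]
    exact hcart.comap_of_isOpenImmersion ι
  -- factor `snd` through the yardstick: `t : M → R`, a blow-up with `t ≫ b = snd`
  obtain ⟨t, ht, htb⟩ := Picover.LocalBlowups.exists_isBlowup_factor hsnd hb hcartM
  -- the fibre-supported desingularization of `M` over `R`
  obtain ⟨M', π', Q', hπ', hQ'supp, hM'reg⟩ := hfib M t _ ht
  -- `σ ∘ ι = φ ∘ b ∘ t`
  have hσι : ∀ m : M, σ (ι m) = φ (b (t m)) := fun m => by
    have h1 : (ι ≫ σ) m = (t ≫ b ≫ φ) m := by rw [hsq, ← htb, Category.assoc]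
    simpa only [Scheme.Hom.comp_apply] using h1
  -- a regular point of `M` alone in its `t`-fibre is off `V(Q')`: the extension `Qe ≠ 0`
  obtain ⟨m₀, hm₀reg, hm₀⟩ := exists_regular_fibre_eq_self ht
  have hm₀Q' : m₀ ∉ (Q'.support : Set M) := fun h => by
    obtain ⟨m₁, hm₁, htm⟩ := hQ'supp m₀ h
    have he : m₁ = m₀ := hm₀ m₁ htm.symm
    rw [he] at hm₁
    exact hm₁ hm₀reg
  have hQeι : (Q'.map ι).comap ι = Q' :=
    Literature.AlgebraicGeometry.Limits.comap_map_of_isOpenImmersion ι Q'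
  have hQe : Q'.map ι ≠ ⊥ := by
    intro h
    apply hm₀Q'
    rw [← hQeι, h, Scheme.IdealSheafData.comap_bot, Scheme.IdealSheafData.support_bot]
    trivial
  -- the new centre lies over `Y ∖ W`
  have hC : IsClosed (σ ⁻¹' W)ᶜ := (hW.preimage σ.continuous).isClosed_compl
  have hQ'C : ι '' (Q'.support : Set M) ⊆ (σ ⁻¹' W)ᶜ := by
    rintro _ ⟨m, hm, rfl⟩ hmem
    obtain ⟨m₁, hm₁, htm⟩ := hQ'supp m hm
    apply hm₁
    refine (mem_regularLocus_iff_of_flat_of_isPreimmersion ι m₁).mpr (hreg (ι m₁) ?_)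
    have hmem' : σ (ι m) ∈ W := hmem
    rwa [hσι, ← htm, ← hσι]
  have hQeC : ((Q'.map ι).support : Set S) ⊆ (σ ⁻¹' W)ᶜ :=
    support_map_subset_of_isClosed ι Q' hC hQ'C
  -- blow `S` up along the extension
  obtain ⟨S₁, τ, hτ⟩ := exists_isBlowup S (Q'.map ι)
  refine ⟨S₁, τ, Q'.map ι, hτ, hQe, fun s hs => ?_, fun s hs => ?_⟩
  · have hτs : τ s ∉ ((Q'.map ι).support : Set S) := fun h => absurd hs (hQeC h)
    exact (mem_regularLocus_iff_of_notMem_support hτ s hτs).mpr (hreg (τ s) hs)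
  · exact mem_regularLocus_of_mem_range ι hπ' hM'reg hτ s hs

/-! ## One phase -/

/-- **One phase of the patching** (`P k → P (k+1)`). Invariant `P k`: a blow-up `σ : S → Y`
along a non-zero ideal sheaf on which every extended centre `(𝓘 j).map (φ j)` is an effective
Cartier divisor and which is regular over the charts `φ j (T j)`, `j < k`. Phase `k` treats the
chart `i` with `i.val = k`: if `S ×_Y T i` is empty nothing changes; otherwise `phase_core`
(with `W = ⋃_{j<k} φ j (T j)`) gives `τ : S₁ → S`, and `τ ≫ σ` is again a blow-up of the
Noetherian `Y` (Stacks 080B, `IsBlowup.exists_isBlowup_comp`) along a non-zero ideal sheaf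
(`S₁` is integral), every extended centre stays Cartier (Stacks 0809,
`IsEffectiveCartier.comap_of_isBlowup`), and `S₁` is regular over the charts `j < k + 1`.
[cite: StacksProject, Tag 080B] -/
theorem phase_step {Y : Scheme.{0}} [IsIntegral Y] [IsNoetherian Y]
    {n : ℕ} {T R : Fin n → Scheme.{0}} (φ : ∀ i, T i ⟶ Y) [∀ i, IsOpenImmersion (φ i)]
    (b : ∀ i, R i ⟶ T i) (𝓘 : ∀ i, (T i).IdealSheafData) [∀ i, IsIntegral (R i)]
    (hb : ∀ i, IsBlowup (b i) (𝓘 i))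
    (hfib : ∀ i, ∀ (M : Scheme.{0}) (π : M ⟶ R i) (Q : (R i).IdealSheafData), IsBlowup π Q →
      ∃ (M' : Scheme.{0}) (π' : M' ⟶ M) (Q' : M.IdealSheafData), IsBlowup π' Q' ∧
        (∀ m ∈ Q'.support, ∃ m₁ : M, m₁ ∉ Scheme.regularLocus M ∧ π m = π m₁) ∧
        Scheme.IsRegular M')
    {k : ℕ} (i : Fin n) (hik : i.val = k)
    {S : Scheme.{0}} {σ : S ⟶ Y} {Q : Y.IdealSheafData} (hσ : IsBlowup σ Q) (hQ : Q ≠ ⊥)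
    (hcart : ∀ j, IsEffectiveCartier (((𝓘 j).map (φ j)).comap σ))
    (hreg : ∀ s : S, (∃ j : Fin n, j.val < k ∧ σ s ∈ Set.range (φ j)) →
      s ∈ Scheme.regularLocus S) :
    ∃ (S₁ : Scheme.{0}) (σ₁ : S₁ ⟶ Y) (Q₁ : Y.IdealSheafData), IsBlowup σ₁ Q₁ ∧ Q₁ ≠ ⊥ ∧
      (∀ j, IsEffectiveCartier (((𝓘 j).map (φ j)).comap σ₁)) ∧
      ∀ s : S₁, (∃ j : Fin n, j.val < k + 1 ∧ σ₁ s ∈ Set.range (φ j)) →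
        s ∈ Scheme.regularLocus S₁ := by
  -- `S` is a Noetherian integral scheme, the chart `φ i` is quasi-compact
  haveI : IsProper σ := hσ.isProper
  haveI : IsLocallyNoetherian S := LocallyOfFiniteType.isLocallyNoetherian σ
  haveI : CompactSpace S := QuasiCompact.compactSpace_of_compactSpace σ
  haveI : IsNoetherian S := {}
  haveI : IsIntegral S := hσ.isIntegral hQ
  haveI : NoetherianSpace (T i) := (φ i).isOpenEmbedding.isInducing.noetherianSpace
  -- the earlier charts: the open `W = ⋃_{j<k} φ j (T j)`
  let W : Set Y := ⋃ j : Fin n, ⋃ _ : j.val < k, Set.range (φ j)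
  have hW : IsOpen W := isOpen_iUnion fun j => isOpen_iUnion fun _ =>
    (φ j).isOpenEmbedding.isOpen_range
  have hmemW : ∀ y : Y, y ∈ W ↔ ∃ j : Fin n, j.val < k ∧ y ∈ Set.range (φ j) := fun y => by
    simp only [W, Set.mem_iUnion, exists_prop]
  have hregW : ∀ s : S, σ s ∈ W → s ∈ Scheme.regularLocus S := fun s hs =>
    hreg s ((hmemW _).mp hs)
  have hrange : Set.range (pullback.fst σ (φ i)) = σ ⁻¹' Set.range (φ i) :=
    Scheme.Pullback.range_fst σ (φ i)
  -- `j < k + 1` means `j < k` or `j = i`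
  have hsplit : ∀ {S' : Scheme.{0}} (g : S' ⟶ Y) (s : S'),
      (∃ j : Fin n, j.val < k + 1 ∧ g s ∈ Set.range (φ j)) →
      g s ∈ W ∨ g s ∈ Set.range (φ i) := by
    rintro S' g s ⟨j, hj, hsj⟩
    rcases Nat.lt_or_ge j.val k with hjk | hjk
    · exact Or.inl ((hmemW _).mpr ⟨j, hjk, hsj⟩)
    · have hji : j = i := Fin.ext (by omega)
      rw [hji] at hsj
      exact Or.inr hsj
  by_cases hM : IsEmpty ↑(pullback σ (φ i))
  · -- the chart misses `σ(S)`: nothing to do in this phase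
    refine ⟨S, σ, Q, hσ, hQ, hcart, fun s hs => ?_⟩
    rcases hsplit σ s hs with h | h
    · exact hregW s h
    · have h' : s ∈ Set.range (pullback.fst σ (φ i)) := by
        rw [hrange]
        exact h
      obtain ⟨m, -⟩ := h'
      exact (hM.false m).elim
  rw [not_isEmpty_iff] at hM
  obtain ⟨S₁, τ, Qe, hτ, hQe, hregW₁, hregι⟩ := phase_core (hb i) (hfib i)
    (pullback.fst σ (φ i)) (pullback.snd σ (φ i)) pullback.condition
    (hσ.pullback_snd_of_flat (φ i)) (hcart i) hW hregW
  obtain ⟨Q₁, hσ₁, -⟩ := hσ.exists_isBlowup_comp hτ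
  -- `S₁` is integral, in particular non-empty: the new centre on `Y` is non-zero
  haveI : IsIntegral S₁ := hτ.isIntegral hQe
  have hQ₁ : Q₁ ≠ ⊥ := by
    rintro rfl
    exact hσ₁.isEmpty_of_bot.false (Classical.arbitrary S₁)
  refine ⟨S₁, τ ≫ σ, Q₁, hσ₁, hQ₁, fun j => ?_, fun s hs => ?_⟩
  · rw [Scheme.IdealSheafData.comap_comp]
    exact (hcart j).comap_of_isBlowup hτ
  · rcases hsplit (τ ≫ σ) s hs with h | h
    · rw [Scheme.Hom.comp_apply] at h
      exact hregW₁ s h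
    · rw [Scheme.Hom.comp_apply] at h
      apply hregι s
      rw [hrange]
      exact h

/-! ## The registered stub -/

/-- **STUB `stub_phasedPatching` of crux `AffineToGlobal` (stmt-ResolutionOfSingularities-15961),
line `Sketch`, registered signature: phased patching.** Given open charts `φ i : T i ↪ Y`
(`i < n`) covering the integral variety `Y`, blow-ups `b i : R i → T i` along `𝓘 i` with
`R i` integral, the fibre-supported desingularization property of every `R i` (`hfib`), and a
blow-up `σ₀ : S₀ → Y` along `J ≠ 0` on which every extended centre `(𝓘 i).map (φ i)` is an
effective Cartier divisor, `Y` has a resolution of singularities. Proof: by induction on the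
phase `k ≤ n` (`phase_step`, starting from `σ₀`) there is a blow-up `σ : S → Y` along a
non-zero ideal sheaf which is regular over the charts `j < k`; at `k = n` the charts cover,
so `S` is regular and `σ` — proper (blow-ups of the Noetherian `Y`, Stacks 02NS) and
birational (Stacks 02ND) — is a resolution (`IsBlowup.isResolution'`).
[cite: StacksProject, Tag 080B] [cite: Temkin2008, Prop. 2.3.4] -/
theorem stub_phasedPatching (K : Type) [Field K] (Y : Scheme.{0}) [IsIntegral Y]
    (f : Y ⟶ Spec (.of K)) [LocallyOfFiniteType f] [QuasiCompact f]
    (n : ℕ) (T R : Fin n → Scheme.{0}) (φ : ∀ i, T i ⟶ Y) [∀ i, IsOpenImmersion (φ i)]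
    (b : ∀ i, R i ⟶ T i) (𝓘 : ∀ i, (T i).IdealSheafData) [∀ i, IsIntegral (R i)]
    (hcov : ∀ y : Y, ∃ i, y ∈ Set.range (φ i)) (hb : ∀ i, IsBlowup (b i) (𝓘 i))
    (hfib : ∀ i, ∀ (M : Scheme.{0}) (π : M ⟶ R i) (Q : (R i).IdealSheafData), IsBlowup π Q →
      ∃ (M' : Scheme.{0}) (π' : M' ⟶ M) (Q' : M.IdealSheafData), IsBlowup π' Q' ∧
        (∀ m ∈ Q'.support, ∃ m₁ : M, m₁ ∉ Scheme.regularLocus M ∧ π m = π m₁) ∧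
        Scheme.IsRegular M')
    (S₀ : Scheme.{0}) (σ₀ : S₀ ⟶ Y) (J : Y.IdealSheafData) (hJ : J ≠ ⊥) (hσ₀ : IsBlowup σ₀ J)
    (hcart : ∀ i, IsEffectiveCartier (((𝓘 i).map (φ i)).comap σ₀)) :
    Scheme.HasResolution Y := by
  haveI : IsLocallyNoetherian Y := LocallyOfFiniteType.isLocallyNoetherian f
  haveI : CompactSpace Y := QuasiCompact.compactSpace_of_compactSpace f
  haveI : IsNoetherian Y := {}
  -- the phases `P k`, `k ≤ n`
  have key : ∀ k : ℕ, k ≤ n → ∃ (S : Scheme.{0}) (σ : S ⟶ Y) (Q : Y.IdealSheafData),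
      IsBlowup σ Q ∧ Q ≠ ⊥ ∧ (∀ j, IsEffectiveCartier (((𝓘 j).map (φ j)).comap σ)) ∧
      ∀ s : S, (∃ j : Fin n, j.val < k ∧ σ s ∈ Set.range (φ j)) →
        s ∈ Scheme.regularLocus S := by
    intro k
    induction k with
    | zero =>
      exact fun _ => ⟨S₀, σ₀, J, hσ₀, hJ, hcart, fun s ⟨j, hj, _⟩ => (Nat.not_lt_zero _ hj).elim⟩
    | succ k ih =>
      intro hk
      obtain ⟨S, σ, Q, hσ, hQ, hc, hr⟩ := ih (Nat.le_of_succ_le hk)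
      exact phase_step φ b 𝓘 hb hfib ⟨k, Nat.lt_of_succ_le hk⟩ rfl hσ hQ hc hr
  -- at `k = n` the charts cover: `S` is regular and `σ` is a resolution
  obtain ⟨S, σ, Q, hσ, hQ, -, hreg⟩ := key n le_rfl
  have hSreg : Scheme.IsRegular S := fun s => by
    obtain ⟨i, hi⟩ := hcov (σ s)
    exact (Scheme.mem_regularLocus s).mp (hreg s ⟨i, i.2, hi⟩)
  exact ⟨S, σ, hσ.isResolution' stacks02NS_holds hQ hSreg⟩

end Summit.ResolutionOfSingularities.ResolutionOfSingularities.Theorems.AffineToGlobal.PhasedPatching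

end
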